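import Mathlib
import HarnessLib
import Literature.AlgebraicGeometry.Ramification.InertiaNormalSylow
import Literature.AlgebraicGeometry.Resolution.ResolutionOfSingularities
import Summits.ResolutionOfSingularities.ResolutionOfSingularities.Theorems.WildQuotientsWildQuotientResolutionTameMove
import Summits.ResolutionOfSingularities.ResolutionOfSingularities.Theorems.WildQuotientsWildQuotientResolutionToralPhaseZero

/-!
# The tame move, ITERABLE form: from a `G`-stable affine cover instead of an affine invariant morphism
# (crux `WildQuotients.WildQuotientResolution`, stub `stub_phaseZeroHighDim`; any dimension)

Crux stmt-ResolutionOfSingularities-15640 (`WildQuotientResolution`), registered stub `stub_phaseZeroHighDim`.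
✓`tameMove` (p819797) blows up the reduced inert locus `Z_K` of a tame normal subgroup `K ⊴ G` of the crux datum
`X′` — finite over `X₁` through the AFFINE invariant `q`, which is used (only) to produce `G`-stable affine
neighbourhoods downstairs (✓`StableAffineCoverBlowup.stub_stableAffineCoverBlowup`). The output `X♯ → X′` is
proper, not affine over `X₁`, so `tameMove` cannot be applied to `X♯` again. The multi-move slices of Phase 0
(several tame moves along `Z_{M₁}, Z_{M₂}, …`, see ✓`PrimeCorePhaseZero` p822058 / ✓`TameCorePhaseZero` p822102 for
the one-move slices) need the move in a form whose hypotheses REPRODUCE themselves. This file provides it: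

* `stableAffineCoverBlowup_of_cover` — Mumford's hypothesis survives an equivariant blow-up, assuming downstairs
  only a `G`-STABLE AFFINE COVER (instead of an affine invariant morphism): same proof as p151564.
* `tameMove'` — **the iterable tame move**: for `G` acting faithfully on an integral regular `X` with a `G`-stable
  affine cover, over an invariant SEPARATED, locally-of-finite-type structure morphism `s : X → Spec k`
  (`char k = p`), and a normal subgroup `1 ≠ K ⊴ G` of order prime to `p`, the blow-up `π : X♯ → X` of `Z_K` with
  the lifted action is proper, birational, `X♯` integral and regular, `π` equivariant, a blow-up of `𝓘_{Z_K}`,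
  `I_x ≤ I_{π x}`, `X♯` has a `G`-stable affine cover — AND the hypotheses hold again for `(X♯, ρ♯, π ≫ s)`:
  `ρ♯` is faithful (✓`injective_of_equivariant_isBirational`) and `π ≫ s` is invariant (separated and locally of
  finite type by instances).

[OURS · crux stmt-ResolutionOfSingularities-15640 · helper toward `stub_phaseZeroHighDim` (iterable form of the
tame move; NOT a proof of the stub); counted 0; AI-level work, weaker than expert review.]
[cite: MumfordAV1970, §7 Thm. p. 66 (proof)] [folklore]
-/

-- single-problem summit: the doubled namespace component `ResolutionOfSingularities` is forced
set_option linter.dupNamespace false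

noncomputable section

open CategoryTheory AlgebraicGeometry TopologicalSpace IsLocalRing
open Literature.AlgebraicGeometry.Resolution Literature.AlgebraicGeometry.Ramification
open Summit.ResolutionOfSingularities.ResolutionOfSingularities.Theorems.WildQuotientResolution
open Summit.ResolutionOfSingularities.ResolutionOfSingularities.Theorems.WildQuotientResolution.StableAffineCoverBlowup

namespace Summit.ResolutionOfSingularities.ResolutionOfSingularities.Theorems.WildQuotientResolution.InertLocusStalk

/-! ## Mumford's hypothesis survives an equivariant blow-up (cover form) -/

/-- **Mumford's hypothesis survives an equivariant blow-up, cover form.** Let the finite group `G` act on the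
separated locally Noetherian `X′`, every point of which has a `G`-stable affine open neighbourhood, and let
`π : X♯ → X′` be a blow-up along an ideal sheaf carrying an action `ρ♯` with `π` equivariant. Then every point
of `X♯` has a `G`-stable affine open neighbourhood (the orbit lies over a stable affine `O`, hence in an affine
open of the blow-up `π⁻¹O → O` by graded prime avoidance; intersect its translates).
[cite: MumfordAV1970, §7 Thm. p. 66 (proof)] -/
theorem stableAffineCoverBlowup_of_cover {X' : Scheme.{0}} [X'.IsSeparated] [IsLocallyNoetherian X']
    {G : Type} [Group G] [Finite G] (ρ : G →* Aut X')
    (hcov : ∀ y : X', ∃ O : X'.Opens, IsAffineOpen O ∧ y ∈ O ∧ ∀ g : G, (ρ g).hom ⁻¹ᵁ O = O)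
    {Xs : Scheme.{0}} {π : Xs ⟶ X'} {J : X'.IdealSheafData} (hπ : IsBlowup π J)
    (ρs : G →* Aut Xs) (hequiv : ∀ g : G, (ρs g).hom ≫ π = π ≫ (ρ g).hom) (x : Xs) :
    ∃ U : Xs.Opens, IsAffineOpen U ∧ x ∈ U ∧ ∀ g : G, (ρs g).hom ⁻¹ᵁ U = U := by
  classical
  let _ : Fintype G := Fintype.ofFinite G
  haveI : IsProper π := hπ.isProper
  haveI : Xs.IsSeparated := Scheme.isSeparated_of_isSeparated_over π
  -- (1) a `G`-stable affine open `O ∋ π x` of `X′`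
  obtain ⟨O, hO, hxO, hOstab⟩ := hcov (π.base x)
  -- (2) the orbit of `x` lies over `O`
  have hmemV : ∀ g : G, (ρs g).hom.base x ∈ π ⁻¹ᵁ O := by
    intro g
    change x ∈ (ρs g).hom ⁻¹ᵁ π ⁻¹ᵁ O
    rw [← Scheme.Hom.comp_preimage, hequiv g, Scheme.Hom.comp_preimage, hOstab g]
    exact hxO
  -- (3) an affine open of `X♯` containing the orbit
  haveI : IsAffine (O : Scheme.{0}) := hO
  have hπO : IsBlowup (π ∣_ O) (J.comap O.ι) := hπ.restrict O
  let S : Finset (π ⁻¹ᵁ O : Scheme.{0}) :=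
    Finset.univ.image fun g : G => (⟨(ρs g).hom.base x, hmemV g⟩ : (π ⁻¹ᵁ O : Scheme.{0}))
  obtain ⟨U₁, hU₁, hSU₁⟩ := exists_isAffineOpen_forall_mem_of_isBlowup hπO S
  let U₀ : Xs.Opens := (π ⁻¹ᵁ O).ι ''ᵁ U₁
  have hU₀ : IsAffineOpen U₀ := hU₁.image_of_isOpenImmersion _
  have hmem : ∀ g : G, (ρs g).hom.base x ∈ U₀ := by
    intro g
    refine ⟨⟨(ρs g).hom.base x, hmemV g⟩, hSU₁ _ ?_, rfl⟩
    exact Finset.mem_image_of_mem _ (Finset.mem_univ g)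
  -- (4) the intersection of the translates of `U₀`
  let U : Xs.Opens := ⨅ g : G, (ρs g).hom ⁻¹ᵁ U₀
  have hUcoe : ((U : Xs.Opens) : Set Xs) = ⋂ g : G, (ρs g).hom.base ⁻¹' (U₀ : Set Xs) := by
    change (((⨅ g : G, (ρs g).hom ⁻¹ᵁ U₀) : Xs.Opens) : Set Xs) = _
    rw [TopologicalSpace.Opens.coe_iInf]
    rfl
  have hxU : x ∈ U := by
    change x ∈ ((U : Xs.Opens) : Set Xs)
    rw [hUcoe]
    exact Set.mem_iInter.mpr fun g => hmem g
  have hstab : ∀ h : G, (ρs h).hom ⁻¹ᵁ U = U := by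
    intro h
    ext1
    rw [TopologicalSpace.Opens.map_coe, hUcoe, Set.preimage_iInter]
    have e : ∀ g : G, (ρs h).hom.base ⁻¹' ((ρs g).hom.base ⁻¹' (U₀ : Set Xs)) =
        (ρs (g * h)).hom.base ⁻¹' (U₀ : Set Xs) := by
      intro g
      rw [← Set.preimage_comp, map_mul, Aut.Aut_mul_def, Iso.trans_hom]
      rfl
    simp_rw [e]
    exact (Equiv.mulRight h).iInf_comp (g := fun g : G => (ρs g).hom.base ⁻¹' (U₀ : Set Xs))
  have hUaff : IsAffineOpen U := IsAffineOpen.iInf fun g => hU₀.preimage (ρs g).hom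
  exact ⟨U, hUaff, hxU, hstab⟩

/-! ## The iterable tame move -/

/-- **The tame move of Phase 0, iterable form** (crux stmt-ResolutionOfSingularities-15640, toward
`stub_phaseZeroHighDim`; any dimension). Let `k` be a field of characteristic `p` and `X` an integral REGULAR
scheme with an invariant separated locally-of-finite-type `s : X → Spec k` (`ρ g ≫ s = s`), a FAITHFUL action `ρ`
of the finite group `G`, and a `G`-stable affine open neighbourhood of every point. For a normal subgroup
`K ⊴ G`, `K ≠ 1`, of order prime to `p`: the blow-up `π : X♯ → X` of the reduced inert locus
`Z_K = {y | K ≤ I_y}` with the lifted action `ρ♯` is proper and birational, `X♯` is integral and regular, `π` is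
equivariant and a blowing up of `𝓘_{Z_K}`, `I_x ≤ I_{π x}`, `X♯` has a `G`-stable affine cover, `ρ♯` is
faithful and `π ≫ s` is invariant — so the theorem applies again to `(X♯, ρ♯, π ≫ s)`. [folklore] -/
theorem tameMove' (p : ℕ) (hp : p.Prime) (k : Type) [Field k] [CharP k p]
    (X : Scheme.{0}) (s : X ⟶ Spec (.of k)) [IsSeparated s] [LocallyOfFiniteType s] [IsIntegral X]
    (G : Type) [Group G] [Finite G] (ρ : G →* Aut X) (hfaith : Function.Injective ρ)
    (hreg : Scheme.IsRegular X) (hρ : ∀ g : G, (ρ g).hom ≫ s = s)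
    (hcov : ∀ y : X, ∃ O : X.Opens, IsAffineOpen O ∧ y ∈ O ∧ ∀ g : G, (ρ g).hom ⁻¹ᵁ O = O)
    (K : Subgroup G) [K.Normal] (hK : K ≠ ⊥) (hcop : (Nat.card K).Coprime p) :
    ∃ (Xs : Scheme.{0}) (π : Xs ⟶ X) (ρs : G →* Aut Xs), IsProper π ∧ IsBirational π ∧
      IsIntegral Xs ∧ Scheme.IsRegular Xs ∧ (∀ g : G, (ρs g).hom ≫ π = π ≫ (ρ g).hom) ∧
      IsBlowup π (Scheme.IdealSheafData.vanishingIdeal ⟨{y : X | K ≤ inertiaSubgroup ρ y},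
        PointMoveNoNpcCurves.isClosed_setOf_le_inertia s ρ hρ K⟩) ∧
      (∀ x : Xs, inertiaSubgroup ρs x ≤ inertiaSubgroup ρ (π.base x)) ∧
      (∀ x : Xs, ∃ U : Xs.Opens, IsAffineOpen U ∧ x ∈ U ∧ ∀ g : G, (ρs g).hom ⁻¹ᵁ U = U) ∧
      Function.Injective ρs ∧ (∀ g : G, (ρs g).hom ≫ (π ≫ s) = π ≫ s) := by
  haveI : Fact p.Prime := ⟨hp⟩
  haveI : IsLocallyNoetherian X := LocallyOfFiniteType.isLocallyNoetherian s
  haveI : X.IsSeparated := Scheme.isSeparated_of_isSeparated_over s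
  have hZ : IsClosed {y : X | K ≤ inertiaSubgroup ρ y} :=
    PointMoveNoNpcCurves.isClosed_setOf_le_inertia s ρ hρ K
  set 𝒥 : X.IdealSheafData :=
    Scheme.IdealSheafData.vanishingIdeal ⟨{y : X | K ≤ inertiaSubgroup ρ y}, hZ⟩ with h𝒥def
  -- residue characteristics of `X`
  have hcharX : ∀ z : X, CharP (ResidueField (X.presheaf.stalk z)) p := fun z =>
    (((IsLocalRing.residue (X.presheaf.stalk z)).comp ((X.presheaf.germ ⊤ z trivial).hom.comp
      ((s.appTop).hom.comp (Scheme.ΓSpecIso (.of k)).inv.hom))).charP_iff_charP p).mp inferInstance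
  -- the centre: non-zero, `G`-stable, regular subscheme
  have hJne : 𝒥 ≠ ⊥ := vanishingIdeal_inertLocus_ne_bot s ρ hρ hfaith K hK hZ
  have h𝒥 : ∀ g : G, 𝒥.comap (ρ g).hom = 𝒥 := comap_vanishingIdeal_inertLocus ρ K hZ
  have hC : Scheme.IsRegular 𝒥.subscheme :=
    isRegular_subscheme_vanishingIdeal_inertLocus_of_coprime ρ K p hZ (fun x _ => hreg x)
      (fun x _ => hcharX x) hcop
  -- the blow-up and the lifted action
  obtain ⟨Xs, π, hπ⟩ := exists_isBlowup X 𝒥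
  let ρs : G →* Aut Xs := hπ.liftAction ρ h𝒥
  have hequiv : ∀ g : G, (ρs g).hom ≫ π = π ≫ (ρ g).hom := hπ.liftAction_hom_comp ρ h𝒥
  haveI hXs : IsIntegral Xs := hπ.isIntegral hJne
  haveI hπp : IsProper π := hπ.isProper
  have hbir : IsBirational π := hπ.isBirational' hJne
  have hXsreg : Scheme.IsRegular Xs := hπ.isRegular_of_isRegular_subscheme hreg hC
  have hρs : ∀ g : G, (ρs g).hom ≫ (π ≫ s) = π ≫ s := fun g => by
    rw [← Category.assoc, hequiv g, Category.assoc, hρ g]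
  have hfaiths : Function.Injective ρs :=
    injective_of_equivariant_isBirational s ρ hfaith hρ π hbir ρs hequiv
  refine ⟨Xs, π, ρs, hπp, hbir, hXs, hXsreg, hequiv, hπ, fun x => ?_, fun x => ?_, hfaiths, hρs⟩
  · exact InertiaLe.stub_inertia_le ρs ρ π hequiv x
  · exact stableAffineCoverBlowup_of_cover ρ hcov hπ ρs hequiv x

/-- **The crux datum satisfies the iterable hypotheses**: for `X′` finite over the separated finite-type `X₁/k`
through the invariant `q`, the structure morphism `q ≫ f` is invariant, separated and locally of finite type, and
`X′` has a `G`-stable affine cover (`q⁻¹` of affine opens of `X₁`, ✓`PClosedCase.exists_isAffineOpen_stable`).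
[folklore] -/
theorem iterHypotheses_of_cruxData {k : Type} [Field k] (X' X₁ : Scheme.{0}) (f : X₁ ⟶ Spec (.of k))
    (q : X' ⟶ X₁) {G : Type} [Group G] (ρ : G →* Aut X') [IsFinite q]
    (hρ : ∀ g : G, (ρ g).hom ≫ q = q) :
    (∀ g : G, (ρ g).hom ≫ (q ≫ f) = q ≫ f) ∧
      ∀ y : X', ∃ O : X'.Opens, IsAffineOpen O ∧ y ∈ O ∧ ∀ g : G, (ρ g).hom ⁻¹ᵁ O = O :=
  ⟨fun g => by rw [← Category.assoc, hρ g], fun y => PClosedCase.exists_isAffineOpen_stable q ρ hρ y⟩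

end Summit.ResolutionOfSingularities.ResolutionOfSingularities.Theorems.WildQuotientResolution.InertLocusStalk

end
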